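import Mathlib
import Summits.ResolutionOfSingularities.ResolutionOfSingularities.Theorems.WeightedInvariantLocalWeightedDropNCPolyBridgeCharts

/-!
# `WeightedInvariant.LocalWeightedDrop`, TOT2-LINE piece S-E2′ (the count-game bridge), part 1c: THE POINT MOVE — every exceptional point is either a
# normal crossing or represents the polyhedron game's point successor

Crux item stmt-ResolutionOfSingularities-8899 `LocalWeightedDrop` (route `ResolutionOfSingularities/WeightedInvariant`), ENGINE skeleton v32
(ddb48572591139d5), registered stub `stub_spaceNCRankDrop`; TOT2-LINE v1.1 §(E) piece S-E2′ (`L/res-L1-w43-lead-1/g4/TOT2-LINE.md`).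
[OURS · L1 W4.3 · chain w43 · lead-1 gen 4.  Port of the point half of the weighted-game bridge (ρ-B) of the line «monic polyhedron descent»
(res-D-pv-058 AS stub-6 / res-type-061: …PolyDescentBridgeSlices; stub worker 3's brick …MonicPointBlowup) from `CobordantGame` successors to the
successors of the NC count game (`TameFourTupleDrop.MoveClause`, res-type-056).  MODEL: Cossart–Jannsen–Saito LNM 2270 §11 Case 1 (point blow-up,
near points on the line `ℙ(Dir)`, Lemmas 11.1/11.2); Perlega arXiv:2011.14443 §7.1 (apposite parameters).  Nothing here is a statement of any
manuscript; the games are the programme's own.  AI-produced, gate-checked, weaker than expert review.]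

* `represents_pointSucc_zero` — slot `u₁` (`c₀ ≠ 0`): the new position `s · G|_{y′₀=0}` represents `blowOneT d (shearT (C (c₁/c₀)) A)` with boundary
  `{u₁} ∪ {u₂ : u₂ ∈ N, c₁ = 0}` (coordinates: undo the plane rescaling of `PolyDescent.slice_zero_eq_blowOneT`, then `y ↦ c₀y`);
* `represents_pointSucc_one` — slot `u₂` at `c₀ = 0`: it represents `blowTwoT d A` with boundary `{u₂} ∪ {u₁ : u₁ ∈ N}`;
* `isStdNC_pointSucc_last` — off the near line (`γ ≠ 0`) the new position is unit × monomial;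
* **`pointMove_of_represents`** — THE POINT MOVE: if `b` represents the positive label `A` (`IsPosT d A`) with boundary `N`, the blow-up of the point
  (the representing coordinates as the move's `Φ`, all weights `1`) is a legal count move (`TameFourTupleDrop.IsCountMove`) and at EVERY exceptional
  point, for every `s`-saturation, some live slot yields a new position which is EITHER unit × monomial OR represents the point-successor label of
  `PolyDescent.succT` before re-preparation (`Represents.shift` re-prepares for free).
-/

set_option linter.dupNamespace false -- mandated namespace of this single-conjunct summit

noncomputable section

namespace Summit.ResolutionOfSingularities.ResolutionOfSingularities.Theorems

namespace NCPoly

open MvPowerSeries Literature.AlgebraicGeometry.Resolution TameFourTupleDrop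

variable {k : Type} [Field k]

/-! ## THE TRANSFER LEMMA: sliced data ⇒ a representation -/

/-- **TRANSFER.**  Suppose the sliced coefficient tuple `S` of a successor is `S_j = γ₁^{d−j} · (L_j ∘ σ)` for a plane change `σ` with inverse `τ`
(`τ∘σ = id`, `τ` legal), and that under `Θ' = (y ↦ γ₁y) ∘ (τ × id_y)` the product `s · P` of the exceptional variable and the sliced planes becomes
`Q · bdry N'` with `Q` a unit.  Then the successor position `s · (V| · monicGerm S · P)` (`V|` a unit) represents `L` with boundary `N'`. -/
theorem represents_of_sliceData {d : ℕ} (L S : Fin d → MvPowerSeries (Fin 2) k) {γ₁ : k} (hγ₁ : γ₁ ≠ 0)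
    (σ τ : Fin 2 → MvPowerSeries (Fin 2) k) (hσ0 : ∀ i, constantCoeff (σ i) = 0) (hτ0 : ∀ i, constantCoeff (τ i) = 0)
    (hτdet : IsUnit (FormalCoordChange.linMat τ).det) (hcomp : ∀ s, subst τ (σ s) = X s)
    (hS : ∀ j, S j = C (γ₁ ^ (d - (j : ℕ))) * subst σ (L j))
    {sV P Q : MvPowerSeries (Fin 3) k} (hsV : constantCoeff sV ≠ 0) (hQ : constantCoeff Q ≠ 0) (N' : Finset (Fin 2))
    (hP : subst (yScale γ₁) (subst (extendLast τ) (X 0 * P)) = Q * bdry N') :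
    Represents (X 0 * (sV * monicGerm d S * P)) d L N' := by
  have hτS : ∀ j, subst τ (S j) = C (γ₁ ^ (d - (j : ℕ))) * L j := fun j => by
    rw [hS j, PolyDescent.subst_C_mul_of_constantCoeff_zero τ hτ0, subst_subst_of_comp_eq_X hσ0 hτ0 hcomp (L j)]
  have hΘ₁0 := constantCoeff_extendLast' τ hτ0
  have hΘ₁s := hasSubst_of_constantCoeff_zero hΘ₁0
  have hΨ0 := constantCoeff_yScale (k := k) γ₁
  have hΨs := hasSubst_of_constantCoeff_zero hΨ0
  have himGerm : subst (yScale γ₁) (subst (extendLast τ) (monicGerm d S)) = C (γ₁ ^ d) * monicGerm d L := by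
    rw [subst_extendLast_monicGerm τ hτ0,
      show (fun j : Fin d => subst τ (S j)) = fun j : Fin d => C (γ₁ ^ (d - (j : ℕ))) * L j from funext hτS, subst_yScale_monicGerm]
  set W : MvPowerSeries (Fin 3) k := subst (yScale γ₁) (subst (extendLast τ) sV) with hW
  have hW0 : constantCoeff W ≠ 0 := by
    rw [hW, constantCoeff_subst_of_constantCoeff_zero _ hΨ0, constantCoeff_subst_of_constantCoeff_zero _ hΘ₁0]; exact hsV
  refine ⟨fun i => subst (yScale γ₁) (extendLast τ i), Q * W * C (γ₁ ^ d), fun i => constantCoeff_comp_eq_zero hΘ₁0 hΨ0 i,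
    ?_, ?_, ?_⟩
  · change IsUnit (FormalCoordChange.linMat (fun i => subst (yScale γ₁) (extendLast τ i))).det
    rw [linMat_comp (extendLast τ) hΨ0, Matrix.det_mul, det_linMat_extendLast, det_linMat_yScale]
    exact hτdet.mul (isUnit_iff_ne_zero.mpr hγ₁)
  · rw [map_mul, map_mul, constantCoeff_C]
    exact mul_ne_zero (mul_ne_zero hQ hW0) (pow_ne_zero d hγ₁)
  · rw [← subst_subst_eq_subst_comp hΘ₁0 hΨ0,
      show X 0 * (sV * monicGerm d S * P) = X 0 * P * sV * monicGerm d S by ring,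
      ← coe_substAlgHom hΘ₁s, map_mul, map_mul, ← coe_substAlgHom hΨs, map_mul, map_mul, coe_substAlgHom, coe_substAlgHom,
      hP, himGerm, ← hW]
    ring

/-- Images of constants under `Θ'`. -/
theorem image_C (γ₁ : k) (τ : Fin 2 → MvPowerSeries (Fin 2) k) (a : k) :
    subst (yScale γ₁) (subst (extendLast τ) (C a : MvPowerSeries (Fin 3) k)) = C a := by
  rw [subst_C, subst_C]

/-- Images of the plane variables under `Θ'`: `X l ↦ C a · X i` when `τ l = C a · X i`. -/
theorem image_X {γ₁ : k} {τ : Fin 2 → MvPowerSeries (Fin 2) k} (hτ0 : ∀ i, constantCoeff (τ i) = 0) {l i : Fin 2} {a : k}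
    (h : τ l = C a * X i) :
    subst (yScale γ₁) (subst (extendLast τ) (X (Fin.castSucc l) : MvPowerSeries (Fin 3) k)) = C a * X (Fin.castSucc i) := by
  rw [subst_X (hasSubst_of_constantCoeff_zero (constantCoeff_extendLast' τ hτ0)), extendLast_castSucc, h, rename_C_mul_X,
    ← coe_substAlgHom (hasSubst_of_constantCoeff_zero (constantCoeff_yScale γ₁)), map_mul, coe_substAlgHom, subst_C,
    subst_yScale_X_castSucc]

/-! ## THE POINT SUCCESSOR AT SLOT `u₁` (`c₀ ≠ 0`) REPRESENTS `blowOneT (shearT (c₁/c₀) A)` -/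

open scoped Classical in
/-- Slot `0`: the new position `s · (V · g₀ · planes)|_{y′₀ = 0}` represents the label `blowOneT d (shearT (C (c₁/c₀)) A)` with boundary
`{u₁} ∪ {u₂ : u₂ ∈ N, c₁ = 0}`. -/
theorem represents_pointSucc_zero {d : ℕ} {A : Fin d → MvPowerSeries (Fin 2) k} (N : Finset (Fin 2)) (pt : Fin 3 → k)
    (hc0 : pt 0 ≠ 0) (B : Fin d → MvPowerSeries (Fin 3) k)
    (hB : ∀ j, subst (CobordantChart.chart (fun _ : Fin 2 => 1) (fun l => pt (Fin.castSucc l))) (A j) = X 0 ^ (d - (j : ℕ) + 1) * B j)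
    {V : MvPowerSeries (Fin 4) k} (hV : constantCoeff V ≠ 0) :
    Represents (X 0 * TupleGame.slice (0 : Fin 3) (V * gZero d 0 B * planes N pt)) d
      (PolyDescent.blowOneT d (PolyDescent.shearT (C (pt 1 / pt 0)) A))
      (insert 0 (N.filter fun l => l = 1 ∧ pt 1 = 0)) := by
  classical
  set τ : Fin 2 → MvPowerSeries (Fin 2) k := PlaneGerm.diagScale (pt 0)⁻¹ (pt 0) with hτ
  have hτ0 : ∀ i, constantCoeff (τ i) = 0 := PlaneGerm.constantCoeff_diagScale _ _
  have hτs := hasSubst_of_constantCoeff_zero hτ0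
  have hτ_apply0 : τ 0 = C (pt 0)⁻¹ * X 0 := by simp [hτ, PlaneGerm.diagScale]
  have hτ_apply1 : τ 1 = C (pt 0) * X 1 := by simp [hτ, PlaneGerm.diagScale]
  rw [slice_mul, slice_mul, show TupleGame.slice (0 : Fin 3) (gZero d 0 B) = monicGerm d (fun j => TupleGame.slice (0 : Fin 2) (X 0 * B j))
      from MonicPointBlowup.slice_g₀ (m := 2) 0 B, slice_zero_planes]
  refine represents_of_sliceData _ _ hc0 (PlaneGerm.diagScale (pt 0) (pt 0)⁻¹) τ (PlaneGerm.constantCoeff_diagScale _ _) hτ0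
    (by rw [hτ, WildPurePower.linMat_diagScale_det, inv_mul_cancel₀ hc0]; exact isUnit_one) (fun s => ?_) (fun j => ?_)
    (by rw [TupleMonomialPhase.constantCoeff_slice]; exact hV)
    (Q := C (pt 0)⁻¹ * (if (0 : Fin 2) ∈ N then C (pt 0) else 1) *
      (if (1 : Fin 2) ∈ N then (if pt 1 = 0 then C (pt 0) else C (pt 1) + C (pt 0) * X 1) else 1)) ?_ _ ?_
  · -- `τ ∘ σ = id`
    fin_cases s
    · show subst τ (PlaneGerm.diagScale (pt 0) (pt 0)⁻¹ 0) = X 0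
      have h0 : PlaneGerm.diagScale (pt 0) (pt 0)⁻¹ 0 = C (pt 0) * X 0 := by simp [PlaneGerm.diagScale]
      rw [h0, PolyDescent.subst_C_mul_of_constantCoeff_zero τ hτ0, subst_X hτs, hτ_apply0, ← mul_assoc, ← map_mul,
        mul_inv_cancel₀ hc0, map_one, one_mul]
    · show subst τ (PlaneGerm.diagScale (pt 0) (pt 0)⁻¹ 1) = X 1
      have h1 : PlaneGerm.diagScale (pt 0) (pt 0)⁻¹ 1 = C (pt 0)⁻¹ * X 1 := by simp [PlaneGerm.diagScale]
      rw [h1, PolyDescent.subst_C_mul_of_constantCoeff_zero τ hτ0, subst_X hτs, hτ_apply1, ← mul_assoc, ← map_mul,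
        inv_mul_cancel₀ hc0, map_one, one_mul]
  · -- the coefficient identification (…PolyDescentBridgeSlices)
    have h := PolyDescent.slice_zero_eq_blowOneT (fun l => pt (Fin.castSucc l)) A B hB hc0 j
    rw [PolyDescent.diagFamily_eq_diagScale] at h
    exact h
  · -- `Q` is a unit
    rw [map_mul, map_mul, constantCoeff_C]
    refine mul_ne_zero (mul_ne_zero (inv_ne_zero hc0) ?_) ?_
    · split_ifs
      · rw [constantCoeff_C]; exact hc0
      · rw [constantCoeff_one]; exact one_ne_zero
    · split_ifs with h1N hp
      · rw [constantCoeff_C]; exact hc0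
      · rw [map_add, map_mul, constantCoeff_C, constantCoeff_C, constantCoeff_X, mul_zero, add_zero]; exact hp
      · rw [constantCoeff_one]; exact one_ne_zero
  · -- the planes
    have himX0 := image_X (γ₁ := pt 0) hτ0 hτ_apply0
    have himX1 := image_X (γ₁ := pt 0) hτ0 hτ_apply1
    have himC := image_C (pt 0) τ
    simp only [Fin.castSucc_zero, Fin.castSucc_one] at himX0 himX1
    have hbd : (bdry (insert 0 (N.filter fun l => l = 1 ∧ pt 1 = 0)) : MvPowerSeries (Fin 3) k) =
        X 0 * (if (1 : Fin 2) ∈ N ∧ pt 1 = 0 then X 1 else 1) := by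
      rw [bdry_eq]
      simp [Finset.mem_insert, Finset.mem_filter]
    have hΘ₁s := hasSubst_of_constantCoeff_zero (constantCoeff_extendLast' τ hτ0)
    have hΨs := hasSubst_of_constantCoeff_zero (constantCoeff_yScale (k := k) (pt 0))
    rw [hbd]
    by_cases h0N : (0 : Fin 2) ∈ N <;> by_cases h1N : (1 : Fin 2) ∈ N <;> by_cases hp : pt 1 = 0 <;>
      simp only [h0N, h1N, hp, ↓reduceIte, and_true, and_false] <;>
      rw [← coe_substAlgHom hΘ₁s, ← coe_substAlgHom hΨs] <;>
      simp only [map_mul, map_add, map_one, map_zero, zero_add] <;>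
      simp only [coe_substAlgHom, himX0, himX1, himC] <;>
      ring

/-! ## THE POINT SUCCESSOR AT SLOT `u₂` (`c₀ = 0`, `c₁ ≠ 0`) REPRESENTS `blowTwoT A` -/

/-- Slot `1` at `c₀ = 0`: the new position `s · (V · g₀ · planes)|_{y′₁ = 0}` represents the label `blowTwoT d A` with boundary `{u₂} ∪ {u₁ : u₁ ∈ N}`
(letters: the exceptional plane is the new `u₂`, the strict transform of `u₁ = 0` the new `u₁`). -/
theorem represents_pointSucc_one {d : ℕ} {A : Fin d → MvPowerSeries (Fin 2) k} (N : Finset (Fin 2)) (pt : Fin 3 → k)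
    (hc0 : pt 0 = 0) (hc1 : pt 1 ≠ 0) (B : Fin d → MvPowerSeries (Fin 3) k)
    (hB : ∀ j, subst (CobordantChart.chart (fun _ : Fin 2 => 1) (fun l => pt (Fin.castSucc l))) (A j) = X 0 ^ (d - (j : ℕ) + 1) * B j)
    {V : MvPowerSeries (Fin 4) k} (hV : constantCoeff V ≠ 0) :
    Represents (X 0 * TupleGame.slice (1 : Fin 3) (V * gZero d 0 B * planes N pt)) d (PolyDescent.blowTwoT d A)
      (insert 1 (N.filter fun l => l = 0)) := by
  classical
  -- the swapped diagonal family (its own inverse up to the constants)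
  set τ : Fin 2 → MvPowerSeries (Fin 2) k :=
    fun l => if l = 0 then C (pt 1)⁻¹ * X 1 else C (pt 1) * (X 0 : MvPowerSeries (Fin 2) k) with hτ
  have hτ0 : ∀ i, constantCoeff (τ i) = 0 := PureDescent.constantCoeff_swapDiag _ _
  have hτs := hasSubst_of_constantCoeff_zero hτ0
  have hτ_apply0 : τ 0 = C (pt 1)⁻¹ * X 1 := by simp [hτ]
  have hτ_apply1 : τ 1 = C (pt 1) * X 0 := by simp [hτ]
  rw [slice_mul, slice_mul, show TupleGame.slice (1 : Fin 3) (gZero d 0 B) = monicGerm d (fun j => TupleGame.slice (1 : Fin 2) (X 0 * B j))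
      from MonicPointBlowup.slice_g₀ (m := 2) 1 B, slice_one_planes, hc0, map_zero, zero_add]
  refine represents_of_sliceData _ _ hc1 τ τ hτ0 hτ0 (by rw [hτ]; exact PureDescent.isUnit_det_swapDiag (inv_ne_zero hc1) hc1)
    (fun s => ?_) (fun j => PolyDescent.slice_one_eq_blowTwoT (fun l => pt (Fin.castSucc l)) A B hB hc0 hc1 j)
    (by rw [TupleMonomialPhase.constantCoeff_slice]; exact hV)
    (Q := C (pt 1)⁻¹ * (if (0 : Fin 2) ∈ N then C (pt 1) else 1) * (if (1 : Fin 2) ∈ N then C (pt 1) else 1)) ?_ _ ?_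
  · -- `τ ∘ τ = id`
    fin_cases s
    · show subst τ (τ 0) = X 0
      rw [hτ_apply0, PolyDescent.subst_C_mul_of_constantCoeff_zero τ hτ0, subst_X hτs, hτ_apply1, ← mul_assoc, ← map_mul,
        inv_mul_cancel₀ hc1, map_one, one_mul]
    · show subst τ (τ 1) = X 1
      rw [hτ_apply1, PolyDescent.subst_C_mul_of_constantCoeff_zero τ hτ0, subst_X hτs, hτ_apply0, ← mul_assoc, ← map_mul,
        mul_inv_cancel₀ hc1, map_one, one_mul]
  · -- `Q` is a unit
    rw [map_mul, map_mul, constantCoeff_C]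
    refine mul_ne_zero (mul_ne_zero (inv_ne_zero hc1) ?_) ?_ <;> split_ifs <;>
      first | (rw [constantCoeff_C]; exact hc1) | (rw [constantCoeff_one]; exact one_ne_zero)
  · -- the planes
    have himX0 := image_X (γ₁ := pt 1) hτ0 hτ_apply0
    have himX1 := image_X (γ₁ := pt 1) hτ0 hτ_apply1
    have himC := image_C (pt 1) τ
    simp only [Fin.castSucc_zero, Fin.castSucc_one] at himX0 himX1
    have hbd : (bdry (insert 1 (N.filter fun l => l = 0)) : MvPowerSeries (Fin 3) k) =
        (if (0 : Fin 2) ∈ N then X 0 else 1) * X 1 := by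
      rw [bdry_eq]
      simp [Finset.mem_insert, Finset.mem_filter]
    have hΘ₁s := hasSubst_of_constantCoeff_zero (constantCoeff_extendLast' τ hτ0)
    have hΨs := hasSubst_of_constantCoeff_zero (constantCoeff_yScale (k := k) (pt 1))
    rw [hbd]
    by_cases h0N : (0 : Fin 2) ∈ N <;> by_cases h1N : (1 : Fin 2) ∈ N <;>
      simp only [h0N, h1N, ↓reduceIte] <;>
      rw [← coe_substAlgHom hΘ₁s, ← coe_substAlgHom hΨs] <;>
      simp only [map_mul, map_one] <;>
      simp only [coe_substAlgHom, himX0, himX1, himC] <;>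
      ring

/-! ## Off the near line (`γ ≠ 0`): a normal crossing -/

/-- At an exceptional point with `γ = c_y ≠ 0` the new position at the `y`-slot is unit × monomial: `s · (V · g · planes)|` with `V`, `g` units
(`g(0) = γ^d ≠ 0` for the strict transforms of monic germs) and every transformed plane `c_l + y′_l` a unit or a variable. -/
theorem isStdNC_succ_last (N : Finset (Fin 2)) (pt : Fin 3 → k) {V g : MvPowerSeries (Fin 4) k} (hV : constantCoeff V ≠ 0)
    (hg : constantCoeff g ≠ 0) : IsStdNC (X 0 * TupleGame.slice (Fin.last 2) (V * g * planes N pt)) := by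
  rw [slice_mul, slice_mul, slice_last_planes]
  refine (isStdNC_X 0).mul (((IsStdNC.of_unit ?_).mul (IsStdNC.of_unit ?_)).mul
    (IsStdNC.prod _ _ fun l _ => isStdNC_C_add_X _ _))
  · rw [TupleMonomialPhase.constantCoeff_slice]; exact hV
  · rw [TupleMonomialPhase.constantCoeff_slice]; exact hg

/-- A non-zero point of `k³` with `c_y = 0` and `c₀ = 0` has `c₁ ≠ 0`. -/
theorem ne_zero_of_two_zero {c : Fin 3 → k} (hc : c ≠ 0) (hγ : c (Fin.last 2) = 0) (hc0 : c 0 = 0) : c 1 ≠ 0 := fun hc1 =>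
  hc (funext fun i => by
    fin_cases i
    · exact hc0
    · exact hc1
    · exact hγ)

/-! ## THE POINT MOVE -/

open scoped Classical in
/-- **THE POINT MOVE of the count-game bridge.**  If `b` represents the positive label `A` with boundary `N`, then blowing up the point — the
representing coordinates `Θ` as the move's coordinate change, all weights `1` — is a legal count move, and at every exceptional point `c ≠ 0` and
every `s`-saturation `s^A · G` of the transform some live slot carries a new position `s · G|` which is
* unit × monomial (hence `GermIsNC`) when `γ = c_y ≠ 0` (off the near line);
* a representation of `blowOneT d (shearT (C (c₁/c₀)) A)` with boundary `{u₁} ∪ {u₂ : u₂ ∈ N, c₁ = 0}` when `γ = 0`, `c₀ ≠ 0`;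
* a representation of `blowTwoT d A` with boundary `{u₂} ∪ {u₁ : u₁ ∈ N}` when `γ = c₀ = 0` (then `c₁ ≠ 0`). -/
theorem pointMove_of_represents {d : ℕ} {A : Fin d → MvPowerSeries (Fin 2) k} (hA : PolyDescent.IsPosT d A)
    {b : MvPowerSeries (Fin 3) k} {N : Finset (Fin 2)} (hrep : Represents b d A N) :
    ∃ Φ : Fin 3 → MvPowerSeries (Fin 3) k, IsCountMove (m := 2) Φ (fun _ => 1) ∧
      MoveClause (m := 2) b Φ (fun _ => 1) (fun b' => IsStdNC b' ∨ ∃ c : Fin 3 → k, c (Fin.last 2) = 0 ∧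
        ((c 0 ≠ 0 ∧ Represents b' d (PolyDescent.blowOneT d (PolyDescent.shearT (C (c 1 / c 0)) A))
            (insert 0 (N.filter fun l => l = 1 ∧ c 1 = 0))) ∨
         (c 0 = 0 ∧ c 1 ≠ 0 ∧ Represents b' d (PolyDescent.blowTwoT d A) (insert 1 (N.filter fun l => l = 0))))) := by
  classical
  obtain ⟨Θ, U, hΘ0, hdet, hU, hb⟩ := hrep
  refine ⟨Θ, ⟨hΘ0, hdet, fun _ => le_rfl, 0, Nat.one_pos⟩, fun c _ hc Aexp G hfac hG => ?_⟩
  obtain ⟨B, hB, -, hGeq⟩ := chart_factorisation hA hU hb c hfac hG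
  subst hGeq
  have hUc : constantCoeff (subst (CobordantChart.chart (fun _ : Fin 3 => 1) c) U) ≠ 0 := by
    rw [constantCoeff_subst_chart_eq]; exact hU
  by_cases hγ : c (Fin.last 2) = 0
  · by_cases hc0 : c 0 = 0
    · have hc1 := ne_zero_of_two_zero hc hγ hc0
      refine ⟨1, hc1, Or.inr ⟨c, hγ, Or.inr ⟨hc0, hc1, ?_⟩⟩⟩
      rw [hγ]
      exact represents_pointSucc_one N c hc0 hc1 B hB hUc
    · refine ⟨0, hc0, Or.inr ⟨c, hγ, Or.inl ⟨hc0, ?_⟩⟩⟩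
      rw [hγ]
      exact represents_pointSucc_zero N c hc0 B hB hUc
  · exact ⟨Fin.last 2, hγ, Or.inl (isStdNC_succ_last N c hUc (by rw [constantCoeff_gZero]; exact pow_ne_zero _ hγ))⟩

end NCPoly

end Summit.ResolutionOfSingularities.ResolutionOfSingularities.Theorems

end
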